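import Mathlib.FieldTheory.Finite.GaloisField
import Mathlib.LinearAlgebra.Matrix.GeneralLinearGroup.Projective
import Literature.NumberTheory.GaloisRepresentations.AdequateSubgroup
import Literature.NumberTheory.GaloisRepresentations.ResidualGaloisRep
import Literature.NumberTheory.GaloisRepresentations.ProjectiveType
import HarnessLib

/-!
# Adequacy of linear groups of degree `p` and of `SL₂(q)`-modules (Guralnick–Herzig–Tiep 2017)

Topic `Literature/RepresentationTheory/FiniteGroups`.  NAMED FACTS (D-0014) from
R. Guralnick, F. Herzig, P. H. Tiep, *Adequate subgroups and indecomposable modules*, J. Eur.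
Math. Soc. **19** (2017) 1231–1291 = arXiv:1405.0043 (bib `GuralnickHerzigTiep2017`; held text
`paper:arxiv-1405.0043`), with the paper's EXTENDED notion of adequacy (§1, p. 3 of the arXiv
text, following Thorne's 2-adic paper [T2]), verbatim:

> "we say that an absolutely irreducible representation `ρ : G → GL(V)` is adequate if:
> • `H¹(G, k) = 0`;  • `H¹(G, (V* ⊗ V)/k) = 0`;  • `End(V)` is spanned by the elements `ρ(g)`
> with `ρ(g)` semisimple.  Note that we allow the case `p = 2` in the definition."

(and: "if `p ∤ dim V`, `k` is a direct summand of `V* ⊗ V` … under the assumption that either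
`p ∤ dim V` or `Hⁱ(G, k) = 0` for `i = 1, 2`, adequacy is equivalent to the two conditions
`Ext¹_G(V, V) = 0`; `End(V)` is spanned by the semisimple `ρ(g)`".)  This differs from Thorne's
2012 Def. 2.3, the tree's `Subgroup.IsThorneAdequate` (`AdequateSubgroup.lean`: `ad⁰`-clauses,
never satisfied when `p ∣ n`, `Subgroup.not_isThorneAdequate_of_natCast_eq_zero`); the extended
notion is the one needed in degree `dim V = p` (Thm. 1.7) and at `p = 3` for symmetric squares
(route `Summits/Langlands/Langlands/Theses/EvenVoidBelowEight.lean`, cruxes C1–C3).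

The three printed statements vendored here (pp. 4, 34 of the arXiv text):

> **Theorem 1.7.** Let `k` be a field of characteristic `p` and `G` a finite group. Let `V` be an
> absolutely irreducible faithful `kG`-module with `dim V = p`. Then precisely one of the
> following holds: • `(G, V)` is adequate; • `G` contains a normal abelian subgroup of index
> `p`; • `p = 3` and the image of `G` in `PGL(V)` is `PSL₂(9)`.
>
> **Corollary 9.4.** Let `V` be nontrivial absolutely irreducible representation of
> `G = SL₂(p^r)` in characteristic `p`. Then either `V` is adequate, or one of the following
> holds: • `r = 1`, `1 < dim(V) = (p ± 1)/2`, and `dim Ext¹_G(V, V) = 1`. • `p^r = 2, 3, 4` and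
> `dim V = p^r`. • `p^r = 9` and `dim V = 3, 6, 9`.
>
> **Corollary 9.5.** Let `G` be a finite group and `V` be a faithful absolutely irreducible
> representation of `G` in odd characteristic `p`. If the image of `G` in `PGL(V)` is
> `PGL₂(p^a)` with `p^a > 3`, then `(G, V)` is adequate.

## Rendering (tree vocabulary; every deviation is a WEAKENING of print)

* `V = kⁿ` with `G` acting through `ρ : G →* GL_n(k)` (`n = dim V`); "faithful" = `ρ` injective;
  "absolutely irreducible" = `IsAbsIrreducible ρ` (`ResidualGaloisRep.lean`); "characteristic
  `p`" = `CharP k p`; "image of `G` in `PGL(V)`" = `projectiveImage ρ ≤ PGL(n, k)`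
  (`ProjectiveType.lean`), compared with Mathlib's `PSL(2, 𝔽₉)` / `PGL(Fin 2, 𝔽_{p^a})`
  (`GaloisField`) through an abstract group isomorphism ("is `PSL₂(9)`", "is `PGL₂(p^a)`").
* Adequacy = `IsGHTAdequate ρ` below: (i) `Hom(G, k) = 0` (`= H¹(G, k)`, trivial action);
  (ii) `H¹(G, End(V)/k) = 0` written on LIFTS to `End(V) = M_n(k)` with the conjugation action
  `g • M = ρ(g) M ρ(g)⁻¹` (`V* ⊗ V = End V`): every map `f : G → M_n(k)` satisfying the cocycle
  identity modulo scalars, `f(gh) ≡ f(g) + g • f(h) (mod k·1)`, is a coboundary modulo scalars,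
  `f(g) ≡ g • m − m (mod k·1)` — exactly the vanishing of `H¹` of the quotient module, since the
  scalars are fixed; (iii) `M_n(k)` is the `k`-span of the `ρ(g)` of order prime to
  `p = ringChar k` ("semisimple": for an element of finite order in characteristic `p`,
  semisimple ⇔ order prime to `p` — the convention of `Subgroup.IsThorneAdequate`, clause (iv)).
* Thm. 1.7: `n = p`; "normal abelian subgroup of index `p`" verbatim (`Subgroup.Normal`,
  commuting elements, `Subgroup.index = p`); "precisely one" = at least one and pairwise
  exclusive.  Cor. 9.4: `G = SL(2, GaloisField p r)`, `0 < r`, acting through any `ρ` (not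
  assumed faithful — the centre may act trivially), "nontrivial" = `ρ ≠ 1`; the first
  exceptional case is recorded WITHOUT its clause `dim Ext¹_G(V, V) = 1` (weaker), and
  `dim V = (p ± 1)/2` is written `2n + 1 = p ∨ 2n = p + 1`.  Cor. 9.5: `p ≠ 2`, `3 < p^a`.

## Not vendored (TODO(general form))

Guralnick–Herzig–Tiep, *Adequate groups of low degree*, Algebra Number Theory 9 (2015) 77–147
= arXiv:1311.1786 (bib `GuralnickHerzigTiep2015`): Thm. 1.2 (weak adequacy when `p > dim W` for
an irreducible `kG⁺`-submodule `W`), Thm. 1.3 (the exception list (a), (b)(i)–(vi): `PSL₂(p)`,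
`SL₂(p)`, `SL₂(p) ∘ SL₂(p^a)`, `SL₂(q)` with `p = (q+1)/2`, `SL₂(2^f)` with `p = 2^f + 1`,
`3·A₆` at `(5, 3)`, `2·A₇` at `(7, 4)`, `SL₂(3^a)` at `(3, 2)`), Cor. 1.4–1.5; and GHT 2017
Prop. 6.6 (imprimitive case: adequate iff `|G/A| ≠ p`), which is phrased inside the case
analysis of Prop. 6.5.  These need the subgroup `G⁺ = O^{p'}(G)` and irreducible
`kG⁺`-submodules, and abstract descriptions of the covering groups `3·A₆`, `2·A₇`; they are left
to a follow-up item.  No discharge is attempted (the proofs rest on the classification-based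
structure theory of [GHT 2015, §2] and on `Ext¹` computations for `SL₂(q)` [AJL]).

## References

* [GuralnickHerzigTiep2017] JEMS 19 (2017) 1231–1291 = arXiv:1405.0043: §1 (definition,
  p. 3; Thm. 1.7, p. 4), Prop. 6.6 (p. 19), Cor. 9.4, Cor. 9.5 (p. 34).  Read 2026-08-17.
* [GuralnickHerzigTiep2015] ANT 9 (2015) 77–147 = arXiv:1311.1786: Thms. 1.1–1.3, Cor. 1.4–1.5
  (pp. 3–4).  Read 2026-08-17.
* [Thorne2012] J. Thorne, J. Inst. Math. Jussieu 11 (2012), Def. 2.3 (tree: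
  `Subgroup.IsThorneAdequate`).
-/

noncomputable section

open scoped MatrixGroups

namespace Literature.RepresentationTheory.FiniteGroups

open Literature.NumberTheory.GaloisRepresentations

universe u v

/-! ### Extended adequacy (Guralnick–Herzig–Tiep 2017, §1) -/

section Adequate

variable {G : Type u} [Group G] {k : Type v} [Field k] {n : ℕ}

/-- **`ρ : G →* GL_n(k)` is adequate in the extended sense of Guralnick–Herzig–Tiep 2017, §1**
(following Thorne [T2]; `p ∣ n` allowed): with `V = kⁿ`, `End V = M_n(k)` under
`g • M = ρ(g) M ρ(g)⁻¹`,
* `addMonoidHom_eq_zero` — `H¹(G, k) = 0` (trivial action): every additive homomorphism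
  `G → k` is zero;
* `exists_sub_coboundary_mem_scalar` — `H¹(G, End(V)/k) = 0`, on lifts: if `f : G → M_n(k)`
  satisfies `f(gh) = f(g) + g • f(h) + c_{g,h} · 1` for some scalars `c_{g,h}`, then
  `f(g) = g • m − m + c_g · 1` for some `m ∈ M_n(k)` and scalars `c_g`;
* `span_eq_top` — `M_n(k)` is spanned over `k` by the `ρ(g)` that are semisimple, i.e. (finite
  order, characteristic `p = ringChar k`) of order prime to `p`.
Absolute irreducibility of `ρ` is the paper's standing hypothesis and is NOT a clause (as for
`Subgroup.IsThorneAdequate`). [cite: GuralnickHerzigTiep2017, §1 (definition of adequate, arXiv p. 3)] -/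
structure IsGHTAdequate (ρ : G →* GL (Fin n) k) : Prop where
  /-- (i) `H¹(G, k) = 0` for the trivial action: `Hom(G, k) = 0`. -/
  addMonoidHom_eq_zero : ∀ f : Additive G →+ k, f = 0
  /-- (ii) `H¹(G, End(V)/k·1) = 0`, written on lifts to `End(V) = M_n(k)`. -/
  exists_sub_coboundary_mem_scalar :
    ∀ f : G → Matrix (Fin n) (Fin n) k,
      (∀ g h : G, ∃ c : k,
        f (g * h) = f g + (ρ g : Matrix (Fin n) (Fin n) k) * f h *
          ((ρ g)⁻¹ : GL (Fin n) k) + c • (1 : Matrix (Fin n) (Fin n) k)) →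
      ∃ (m : Matrix (Fin n) (Fin n) k) (c : G → k), ∀ g : G,
        f g = (ρ g : Matrix (Fin n) (Fin n) k) * m * ((ρ g)⁻¹ : GL (Fin n) k) - m +
          c g • (1 : Matrix (Fin n) (Fin n) k)
  /-- (iii) `End(V)` is spanned by the semisimple (`p'`-order) elements `ρ(g)`. -/
  span_eq_top :
    Submodule.span k {M : Matrix (Fin n) (Fin n) k |
      ∃ g : G, (orderOf (ρ g)).Coprime (ringChar k) ∧ M = (ρ g : Matrix (Fin n) (Fin n) k)} = ⊤

/-- Non-vacuity / sanity check: the trivial group acting on the line `k¹` is adequate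
(`Hom(1, k) = 0`; a cocycle modulo scalars on the trivial group is a scalar; `M₁(k) = k · 1`).
[folklore] -/
theorem isGHTAdequate_one_punit : IsGHTAdequate (1 : PUnit.{u + 1} →* GL (Fin 1) k) := by
  refine ⟨fun f => ?_, fun f hf => ?_, ?_⟩
  · refine AddMonoidHom.ext fun x => ?_
    rw [Subsingleton.elim x 0, map_zero, AddMonoidHom.zero_apply]
  · obtain ⟨c, hc⟩ := hf PUnit.unit PUnit.unit
    refine ⟨0, fun _ => -c, fun g => ?_⟩
    have hu : PUnit.unit * PUnit.unit = PUnit.unit := Subsingleton.elim _ _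
    rw [hu] at hc
    rw [Subsingleton.elim g PUnit.unit]
    simp only [MonoidHom.one_apply, inv_one, Units.val_one, Matrix.mul_one, Matrix.one_mul,
      mul_zero, sub_zero, zero_add, neg_smul] at hc ⊢
    -- `hc : f () = f () + f () + c • 1`
    have h3 : f PUnit.unit + (f PUnit.unit + c • (1 : Matrix (Fin 1) (Fin 1) k)) =
        f PUnit.unit + 0 := by
      rw [add_zero, ← add_assoc]
      exact hc.symm
    exact eq_neg_of_add_eq_zero_left (add_left_cancel h3)
  · rw [Submodule.eq_top_iff']
    intro M
    have hM : M = M 0 0 • (1 : Matrix (Fin 1) (Fin 1) k) := by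
      ext i j
      fin_cases i; fin_cases j
      simp
    rw [hM]
    refine Submodule.smul_mem _ _ (Submodule.subset_span ⟨PUnit.unit, ?_, ?_⟩)
    · simp
    · simp

/-- "Precisely one of `A`, `B`, `C` holds": at least one holds and no two hold together.
[folklore] -/
def ExactlyOneOfThree (A B C : Prop) : Prop :=
  (A ∨ B ∨ C) ∧ ¬ (A ∧ B) ∧ ¬ (A ∧ C) ∧ ¬ (B ∧ C)

/-- Unfolding lemma for `ExactlyOneOfThree`. [folklore] -/
theorem exactlyOneOfThree_iff (A B C : Prop) :
    ExactlyOneOfThree A B C ↔ (A ∨ B ∨ C) ∧ ¬ (A ∧ B) ∧ ¬ (A ∧ C) ∧ ¬ (B ∧ C) :=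
  Iff.rfl

end Adequate

/-! ### The named facts -/

/-- **Guralnick–Herzig–Tiep 2017, Theorem 1.7** (JEMS 19; arXiv:1405.0043 p. 4): "Let `k` be a
field of characteristic `p` and `G` a finite group. Let `V` be an absolutely irreducible faithful
`kG`-module with `dim V = p`. Then precisely one of the following holds: • `(G, V)` is adequate;
• `G` contains a normal abelian subgroup of index `p`; • `p = 3` and the image of `G` in `PGL(V)`
is `PSL₂(9)`."  Rendering: `ρ : G →* GL_p(k)` injective and absolutely irreducible, `CharP k p`;
adequate = `IsGHTAdequate ρ` (the paper's extended notion, module docstring); the second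
alternative verbatim; the third as an abstract isomorphism `projectiveImage ρ ≃* PSL(2, 𝔽₉)`
(`𝔽₉ = GaloisField 3 2`; `PSL₂(9) ≅ A₆`); "precisely one" = at least one holds and no two hold
together (`ExactlyOneOfThree`). [cite: GuralnickHerzigTiep2017, Thm. 1.7] -/
def GuralnickHerzigTiep2017_thm_1_7 : Prop :=
  ∀ (k : Type) [Field k] (p : ℕ) [Fact p.Prime] [CharP k p]
    (G : Type) [Group G] [Finite G] (ρ : G →* GL (Fin p) k),
    Function.Injective ρ → IsAbsIrreducible ρ →
      ExactlyOneOfThree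
        (IsGHTAdequate ρ)
        (∃ N : Subgroup G, N.Normal ∧ (∀ x ∈ N, ∀ y ∈ N, x * y = y * x) ∧ N.index = p)
        (p = 3 ∧ Nonempty (projectiveImage ρ ≃* PSL(2, GaloisField 3 2)))

/-- **Guralnick–Herzig–Tiep 2017, Corollary 9.4** (arXiv p. 34): "Let `V` be nontrivial
absolutely irreducible representation of `G = SL₂(p^r)` in characteristic `p`. Then either `V`
is adequate, or one of the following holds: • `r = 1`, `1 < dim(V) = (p ± 1)/2`, and
`dim Ext¹_G(V, V) = 1`. • `p^r = 2, 3, 4` and `dim V = p^r`. • `p^r = 9` and `dim V = 3, 6, 9`."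
Rendering: `G = SL(2, GaloisField p r)`, `0 < r`, acting on `kⁿ` through any homomorphism `ρ`
(`CharP k p`; `ρ` absolutely irreducible and `≠ 1`); adequate = `IsGHTAdequate ρ`; the first
exceptional alternative is recorded WITHOUT the clause `dim Ext¹ = 1` (so the disjunction is
weaker than printed), with `dim V = (p ± 1)/2` written `2n + 1 = p ∨ 2n = p + 1`.
[cite: GuralnickHerzigTiep2017, Cor. 9.4] -/
def GuralnickHerzigTiep2017_cor_9_4 : Prop :=
  ∀ (k : Type) [Field k] (p : ℕ) [Fact p.Prime] [CharP k p] (r : ℕ), 0 < r →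
    ∀ (n : ℕ) (ρ : SL(2, GaloisField p r) →* GL (Fin n) k), IsAbsIrreducible ρ → ρ ≠ 1 →
      IsGHTAdequate ρ ∨
        (r = 1 ∧ 1 < n ∧ (2 * n + 1 = p ∨ 2 * n = p + 1)) ∨
        ((p ^ r = 2 ∨ p ^ r = 3 ∨ p ^ r = 4) ∧ n = p ^ r) ∨
        (p ^ r = 9 ∧ (n = 3 ∨ n = 6 ∨ n = 9))

/-- **Guralnick–Herzig–Tiep 2017, Corollary 9.5** (arXiv p. 34): "Let `G` be a finite group and
`V` be a faithful absolutely irreducible representation of `G` in odd characteristic `p`. If the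
image of `G` in `PGL(V)` is `PGL₂(p^a)` with `p^a > 3`, then `(G, V)` is adequate."  Rendering:
`ρ : G →* GL_n(k)` injective and absolutely irreducible, `CharP k p`, `p ≠ 2`; the image
condition as an abstract isomorphism `projectiveImage ρ ≃* PGL(Fin 2, 𝔽_{p^a})`
(`GaloisField p a`), `3 < p^a`; adequate = `IsGHTAdequate ρ`.  (Serves route `EvenVoidBelowEight`:
residual images `PGL₂(𝔽_{3^a})`, `PGL₂(𝔽₉)` at `p = 3`.) [cite: GuralnickHerzigTiep2017, Cor. 9.5] -/
def GuralnickHerzigTiep2017_cor_9_5 : Prop :=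
  ∀ (k : Type) [Field k] (p : ℕ) [Fact p.Prime] [CharP k p], p ≠ 2 →
    ∀ (G : Type) [Group G] [Finite G] (n : ℕ) (ρ : G →* GL (Fin n) k),
      Function.Injective ρ → IsAbsIrreducible ρ →
        ∀ a : ℕ, 3 < p ^ a →
          Nonempty (projectiveImage ρ ≃* PGL(Fin 2, GaloisField p a)) →
            IsGHTAdequate ρ

end Literature.RepresentationTheory.FiniteGroups

end
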